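import Literature.MathematicalPhysics.QuantumLattice.SU2Haar
import HarnessLib

/-!
# Haar measure on `SU(2)`: small balls around the identity

Sibling proof file of `SU2Haar.lean` (all statements proved, no definitions): a polynomial
lower bound for the normalised Haar measure of trace-neighbourhoods of the identity in
`SU(2) = Matrix.specialUnitaryGroup (Fin 2) ℂ`,

  `Haar {U : 2 − Re tr U ≤ η} ≥ η²/16`  for `0 < η ≤ 1/4`

(`le_haarProbability_su2_two_sub_trace_le`). On `SU(2)` the Frobenius distance to the identity is
`‖1 − U‖²_F = 4 − 2 Re tr U`, so this is the ball `‖1 − U‖_F ≤ √(2η)`; the true order is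
`η^{3/2}`, but any power law is what enters Chatterjee's key estimate (Probab. Math. Phys. 7
(2026) 339, arXiv:2401.10507, Lemma 5.5: "the normalized Haar measure of `Σ'` is
`≥ (C₁α)^{-C₂Lᵈ}`", with `Σ' = {‖I − U_e‖ ≤ α⁻¹ ∀ e}`), DAG node N3 of the proof plan for
constructive-qft.S19 (`ContinuumLimits.chatterjee_su2_higgs`).

Proof: by the ball-cone description of Haar measure (`haarProbability_su2_eq_su2BallMeasure`:
Haar is the law of the radial projection `quatToSU2 x` of `x` uniform in the unit ball of `ℍ`),
it suffices to exhibit a Euclidean ball inside the unit ball whose projection lies in the set: the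
ball of radius `ρ = √η/2 ≤ 1/4` around the real quaternion `3/4` works
(`two_sub_trace_re_quatToSU2_le`: there `re x ≥ 1/2`, `‖x‖ < 1` and
`2 − Re tr (quatToSU2 x) = 2(‖x‖ − re x)/‖x‖ ≤ 4 |im x|² < 4ρ² = η`), and its volume is
`ρ⁴ = η²/16` times that of the unit ball (`Measure.addHaar_ball_of_pos`, `finrank ℝ ℍ = 4`).
-/

open MeasureTheory Quaternion Filter Topology
open scoped Quaternion ENNReal

noncomputable section

namespace Literature.MathematicalPhysics.QuantumLattice

/-- `SU(2)` as Mathlib's `Matrix.specialUnitaryGroup (Fin 2) ℂ` (file-local notation, as in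
`SU2Haar.lean`). -/
local notation "SU2" => Matrix.specialUnitaryGroup (Fin 2) ℂ

attribute [local instance] Literature.Analysis.FluidPDE.Tao2016.quatMeasurableSpace
  Literature.Analysis.FluidPDE.Tao2016.quatBorelSpace secondCountableTopology_su2

/-! ### Small balls around the identity have polynomially large Haar measure -/

/-- The trace of `quatMatrix q` is `2 re q`. [folklore] -/
theorem trace_quatMatrix_re (q : ℍ) : ((quatMatrix q).trace).re = 2 * q.re := by
  simp [Matrix.trace, Fin.sum_univ_two]
  ring

/-- The trace of `quatToSU2 x` (`x ≠ 0`) has real part `2 re x / ‖x‖`. [folklore] -/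
theorem trace_quatToSU2_re {x : ℍ} (hx : x ≠ 0) :
    (((quatToSU2 x : SU2) : Matrix (Fin 2) (Fin 2) ℂ).trace).re = 2 * (‖x‖⁻¹ * x.re) := by
  rw [coe_quatToSU2 hx, trace_quatMatrix_re]
  simp [Quaternion.re_smul]

/-- `‖q‖² = re² + imI² + imJ² + imK²`. [folklore] -/
theorem sq_norm_eq_sum_sq (q : ℍ) : ‖q‖ ^ 2 = q.re ^ 2 + q.imI ^ 2 + q.imJ ^ 2 + q.imK ^ 2 := by
  rw [sq, ← Quaternion.normSq_eq_norm_mul_self, Quaternion.normSq_def']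

/-- **Trace deficiency near the positive real axis.** If `x ∈ ℍ` lies in the ball of radius
`ρ ≤ 1/4` around the real quaternion `3/4`, then `x ≠ 0`, `‖x‖ < 1`, and the radial projection
is close to the identity: `2 − Re tr (quatToSU2 x) ≤ 4 ρ²`
(since `‖x‖ − re x = |im x|²/(‖x‖ + re x) ≤ |im x|² < ρ²` and `‖x‖ ≥ 1/2`). [folklore] -/
theorem two_sub_trace_re_quatToSU2_le {ρ : ℝ} (hρ : ρ ≤ 1 / 4) {x : ℍ}
    (hx : x ∈ Metric.ball (((3 / 4 : ℝ) : ℍ)) ρ) :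
    x ≠ 0 ∧ ‖x‖ < 1 ∧
      2 - (((quatToSU2 x : SU2) : Matrix (Fin 2) (Fin 2) ℂ).trace).re ≤ 4 * ρ ^ 2 := by
  rw [Metric.mem_ball, dist_eq_norm] at hx
  have hρpos : 0 < ρ := lt_of_le_of_lt (norm_nonneg _) hx
  have hy2 : ‖x - ((3 / 4 : ℝ) : ℍ)‖ ^ 2 < ρ ^ 2 := pow_lt_pow_left₀ hx (norm_nonneg _) two_ne_zero
  rw [sq_norm_eq_sum_sq] at hy2
  simp only [Quaternion.re_sub, Quaternion.re_coe, Quaternion.imI_sub, Quaternion.imI_coe,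
    sub_zero, Quaternion.imJ_sub, Quaternion.imJ_coe, Quaternion.imK_sub, Quaternion.imK_coe] at hy2
  set S : ℝ := x.imI ^ 2 + x.imJ ^ 2 + x.imK ^ 2 with hS
  have hS0 : 0 ≤ S := by positivity
  have hSρ : S < ρ ^ 2 := by nlinarith [sq_nonneg (x.re - 3 / 4)]
  have h1 : (x.re - 3 / 4) ^ 2 < ρ ^ 2 := by nlinarith
  have h2 : |x.re - 3 / 4| < ρ := abs_lt_of_sq_lt_sq h1 hρpos.le
  have hre : 1 / 2 ≤ x.re := by
    have := (abs_lt.1 h2).1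
    linarith
  have hx0 : x ≠ 0 := by
    intro h
    rw [h, Quaternion.re_zero] at hre
    norm_num at hre
  set n : ℝ := ‖x‖ with hn
  have hn0 : 0 ≤ n := norm_nonneg _
  have hn2 : n ^ 2 = x.re ^ 2 + S := by rw [hn, sq_norm_eq_sum_sq, hS]; ring
  have hnre : x.re ≤ n := by nlinarith
  have hnpos : 0 < n := lt_of_lt_of_le (by norm_num) (hre.trans hnre)
  have hn1 : n < 1 := by
    have h := norm_add_le (x - ((3 / 4 : ℝ) : ℍ)) ((3 / 4 : ℝ) : ℍ)
    rw [sub_add_cancel, Quaternion.norm_coe, Real.norm_of_nonneg (by norm_num : (0 : ℝ) ≤ 3 / 4)] at h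
    linarith
  refine ⟨hx0, hn1, ?_⟩
  rw [trace_quatToSU2_re hx0]
  have hnr : n - x.re ≤ S := by nlinarith
  have key : 2 * (n - x.re) ≤ 4 * ρ ^ 2 * n := by nlinarith
  have hinv : n⁻¹ * n = 1 := inv_mul_cancel₀ hnpos.ne'
  have key' : n⁻¹ * (2 * (n - x.re)) ≤ n⁻¹ * (4 * ρ ^ 2 * n) :=
    mul_le_mul_of_nonneg_left key (inv_pos.2 hnpos).le
  have h4 : ρ ^ 2 * (n⁻¹ * n) = ρ ^ 2 := by rw [hinv, mul_one]
  linarith [key', hinv, h4]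

/-- **Haar measure of trace-neighbourhoods of the identity in `SU(2)`** (small-ball lower
bound): for `0 < η ≤ 1/4`, `Haar {U ∈ SU(2) : 2 − Re tr U ≤ η} ≥ η²/16`. (On `SU(2)`,
`‖1 − U‖²_F = 4 − 2 Re tr U`, so this is the ball `‖1 − U‖_F ≤ √(2η)`; the true order is `η^{3/2}`,
any power law suffices for Chatterjee's Lemma 5.5, where it enters as
"the normalized Haar measure of `Σ'` is `≥ (C₁α)^{-C₂ Lᵈ}`".) Proof: the radial projection of the
Euclidean ball of radius `√η/2` around the real quaternion `3/4` lands in the set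
(`two_sub_trace_re_quatToSU2_le`), and that ball has `(√η/2)⁴ = η²/16` times the volume of the
unit ball (`Measure.addHaar_ball_of_pos`, `finrank ℝ ℍ = 4`).
[cite: Chatterjee2026YMHiggs, proof of Lemma 5.5 (Haar measure of Σ')] -/
theorem le_haarProbability_su2_two_sub_trace_le {η : ℝ} (hη0 : 0 < η) (hη : η ≤ 1 / 4) :
    ENNReal.ofReal (η ^ 2 / 16) ≤
      QuantumFieldTheory.haarProbability SU2
        {U : SU2 | 2 - ((U : Matrix (Fin 2) (Fin 2) ℂ).trace).re ≤ η} := by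
  set ρ : ℝ := Real.sqrt η / 2 with hρ
  have hρpos : 0 < ρ := by positivity
  have hρle : ρ ≤ 1 / 4 := by
    have h : Real.sqrt η ≤ 1 / 2 := by
      rw [show (1 / 2 : ℝ) = Real.sqrt (1 / 4) by
        rw [show (1 / 4 : ℝ) = (1 / 2) ^ 2 by norm_num, Real.sqrt_sq (by norm_num)]]
      exact Real.sqrt_le_sqrt hη
    rw [hρ]; linarith
  have hρη : 4 * ρ ^ 2 = η := by
    rw [hρ, div_pow, Real.sq_sqrt hη0.le]; ring
  have hρ4 : ρ ^ 4 = η ^ 2 / 16 := by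
    rw [show ρ ^ 4 = (ρ ^ 2) ^ 2 by ring, show ρ ^ 2 = η / 4 by linarith]; ring
  -- the target set is closed, hence measurable
  set T : Set SU2 := {U : SU2 | 2 - ((U : Matrix (Fin 2) (Fin 2) ℂ).trace).re ≤ η} with hT
  have hTm : MeasurableSet T := by
    refine (isClosed_le ?_ continuous_const).measurableSet
    exact continuous_const.sub
      (Complex.continuous_re.comp (continuous_subtype_val.matrix_trace))
  -- the Euclidean ball around `3/4` projects into `T` and lies in the unit ball
  have hsub : Metric.ball (((3 / 4 : ℝ) : ℍ)) ρ ⊆ quatToSU2 ⁻¹' T ∩ Metric.ball 0 1 := by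
    intro x hx
    obtain ⟨-, hx1, hxT⟩ := two_sub_trace_re_quatToSU2_le hρle hx
    refine ⟨?_, by simpa using hx1⟩
    show 2 - (((quatToSU2 x : SU2) : Matrix (Fin 2) (Fin 2) ℂ).trace).re ≤ η
    rw [← hρη]; exact hxT
  rw [haarProbability_su2_eq_su2BallMeasure, su2BallMeasure, Measure.smul_apply,
    Measure.map_apply measurable_quatToSU2 hTm,
    Measure.restrict_apply (measurable_quatToSU2 hTm), smul_eq_mul]
  calc ENNReal.ofReal (η ^ 2 / 16)
      = ((volume : Measure ℍ) (Metric.ball 0 1))⁻¹ *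
          (ENNReal.ofReal (ρ ^ 4) * (volume : Measure ℍ) (Metric.ball 0 1)) := by
        rw [← mul_assoc, mul_comm _ (ENNReal.ofReal _), mul_assoc,
          ENNReal.inv_mul_cancel volume_ball_quat_ne_zero volume_ball_quat_ne_top, mul_one, hρ4]
    _ = ((volume : Measure ℍ) (Metric.ball 0 1))⁻¹ *
          (volume : Measure ℍ) (Metric.ball (((3 / 4 : ℝ) : ℍ)) ρ) := by
        rw [Measure.addHaar_ball_of_pos _ _ hρpos, Quaternion.finrank_eq_four]
    _ ≤ ((volume : Measure ℍ) (Metric.ball 0 1))⁻¹ *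
          (volume : Measure ℍ) (quatToSU2 ⁻¹' T ∩ Metric.ball 0 1) :=
        mul_le_mul_right (measure_mono hsub) _

end Literature.MathematicalPhysics.QuantumLattice
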